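import Summits.CriticalPhenomena.PercolationContinuityZ3.Theorems.SubpolynomialBlocking.Negative.Strengthenings
import Summits.CriticalPhenomena.PercolationContinuityZ3.Theorems.PercNonProliferationSubpolynomialBlockingStubTiling
import Summits.CriticalPhenomena.PercolationContinuityZ3.Theorems.PercNonProliferationSubpolynomialBlockingStubUpperSandwich
import Literature.Probability.Percolation.CornerPercolation

/-!
# `SubpolynomialBlocking` — negative knowledge IV: shape of the two OPEN stubs of line `cross-sandwich-flat-seal`

Support file for crux item stmt-CriticalPhenomena-4446 (`PercNonProliferation.SubpolynomialBlocking`), written by the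
line's deep refuter (refuter-drefute-stmt-CriticalPhenomena-4446-g2-0). The registered skeleton (sha 0c6ebc429496) has two
open stubs, both about SEALS of coordinate boxes `Set.Icc 0 hi ⊆ ℤ³` across direction `0` at `p_c(ℤ³)`:

* `stub_anchor`     : `∀ s > 0, ∀ᶠ n, n^{-s} ≤ q_n`,            `q_n = cubeSeal p_c n`  (cube `[0,n]³`);
* `stub_comparison` : `∃ k ≥ 1, ∃ C c > 0, ∀ᶠ n, c q_n^C ≤ seed_k(n)`, `seed_k(n) = flatSeal p_c k n`
  (flat seed `[0,n] × [0, n + ⌊n/k⌋]²`).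

This file fixes importable names for these two numbers (`sealProb`, `cubeSeal`, `flatSeal`; the registered signatures
are recovered by `rfl`, see `cubeSeal_eq` / `flatSeal_eq`) and proves what is known about them unconditionally:

* `pow_le_real_cubeCrossing`, `cubeSeal_le_one_sub_pow`, `cubeSeal_lt_one` — a straight open column crosses the cube,
  so `q_n(p) ≤ 1 - p^n < 1` for `p > 0`; `cubeSeal_criticalProb_pos` — `q_n > 0` (`n ≥ 2`) from the LANDED sandwich
  `0 < u_n ≤ q_n⁶` (`stub_upperSandwich`, `blockProb_criticalProb_three_pos`);
* `flatSeal_le_cubeSeal` — `seed_k(n) ≤ q_n` (restriction, `StubTiling.seal_mono`): the comparison stub is the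
  two-sided statement `c q_n^C ≤ seed_k(n) ≤ q_n`;
* REFUTED NATURAL STRENGTHENINGS of `stub_anchor` (same shapes as `Negative.Strengthenings` for the crux):
  `not_cubeSealSubpoly_forall_n` ("for all `n ≥ 1`" is false at `n = 1`), `not_cubeSealSubpoly_uniform_in_s`
  (`∃ N ∀ s ∀ n ≥ N` is false), `not_cubeSeal_exponent_zero` (`s = 0` is false);
* `flatSeal_zero`, `seedFromCube_without_guard` — WITHOUT the guard `1 ≤ k` the comparison stub is TRIVIALLY TRUE
  (`k = 0`: `n / 0 = 0`, the seed is the cube), i.e. the guard is load-bearing against triviality, not against falsity.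

Nothing here bears on the truth of the two stubs as registered (both are open and numerically supported, see the
drefute reports in `Cruxes/SubpolynomialBlocking/`); the file records the exact shape a proof or a refutation must respect.
-/

noncomputable section

namespace Summit.CriticalPhenomena.PercolationContinuityZ3.Theorems.SubpolynomialBlocking.Negative

open MeasureTheory Filter Topology
open Literature.Probability.Percolation Literature.Probability.LatticeModels
open Literature.Probability.Percolation.DCT16
open Summit.CriticalPhenomena.PercolationContinuityZ3.Theses

/-! ## The objects -/

/-- Probability that the coordinate box `Set.Icc 0 hi ⊆ ℤ³` is SEALED across direction `0`: no open path inside the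
box joins its face `{x 0 = 0}` to its face `{x 0 = hi 0}` (registered vocabulary of the line's stubs). -/
def sealProb (p : unitInterval) (hi : Site 3) : ℝ :=
  (bondPercolation (zdGraph 3) p).real
    (openCrossing (Set.Icc (0 : Site 3) hi) {x | x ∈ Set.Icc (0 : Site 3) hi ∧ x 0 = 0}
      {y | y ∈ Set.Icc (0 : Site 3) hi ∧ y 0 = hi 0})ᶜ

/-- `q_n(p)`: the cube `[0,n]³` sealed between its two `0`-faces — the ANCHOR object. -/
def cubeSeal (p : unitInterval) (n : ℕ) : ℝ := sealProb p ![(n : ℤ), (n : ℤ), (n : ℤ)]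

/-- `seed_k(n, p)`: the flat seed `[0,n] × [0, n + ⌊n/k⌋]²` sealed across its thin direction `0` — the COMPARISON object. -/
def flatSeal (p : unitInterval) (k n : ℕ) : ℝ :=
  sealProb p ![(n : ℤ), (n : ℤ) + (n / k : ℕ), (n : ℤ) + (n / k : ℕ)]

/-- Readback: `cubeSeal` IS the registered expression of `stub_anchor` / `stub_upperSandwich` (definitional). -/
theorem cubeSeal_eq (p : unitInterval) (n : ℕ) :
    cubeSeal p n = (bondPercolation (zdGraph 3) p).real
      (openCrossing (Set.Icc (0 : Site 3) ![(n : ℤ), (n : ℤ), (n : ℤ)])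
        {x | x ∈ Set.Icc (0 : Site 3) ![(n : ℤ), (n : ℤ), (n : ℤ)] ∧ x 0 = 0}
        {y | y ∈ Set.Icc (0 : Site 3) ![(n : ℤ), (n : ℤ), (n : ℤ)] ∧ y 0 = (n : ℤ)})ᶜ := rfl

/-- Readback: `flatSeal` IS the registered expression of `stub_comparison` / `stub_tiling` (definitional). -/
theorem flatSeal_eq (p : unitInterval) (k n : ℕ) :
    flatSeal p k n = (bondPercolation (zdGraph 3) p).real
      (openCrossing (Set.Icc (0 : Site 3) ![(n : ℤ), (n : ℤ) + (n / k : ℕ), (n : ℤ) + (n / k : ℕ)])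
        {x | x ∈ Set.Icc (0 : Site 3) ![(n : ℤ), (n : ℤ) + (n / k : ℕ), (n : ℤ) + (n / k : ℕ)] ∧ x 0 = 0}
        {y | y ∈ Set.Icc (0 : Site 3) ![(n : ℤ), (n : ℤ) + (n / k : ℕ), (n : ℤ) + (n / k : ℕ)] ∧
          y 0 = (n : ℤ)})ᶜ := rfl

/-- A seal probability is non-negative. -/
theorem sealProb_nonneg (p : unitInterval) (hi : Site 3) : 0 ≤ sealProb p hi := measureReal_nonneg
/-- A seal probability is at most one. -/
theorem sealProb_le_one (p : unitInterval) (hi : Site 3) : sealProb p hi ≤ 1 := measureReal_le_one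
/-- `0 ≤ q_n(p)`. -/
theorem cubeSeal_nonneg (p : unitInterval) (n : ℕ) : 0 ≤ cubeSeal p n := sealProb_nonneg p _
/-- `q_n(p) ≤ 1`. -/
theorem cubeSeal_le_one (p : unitInterval) (n : ℕ) : cubeSeal p n ≤ 1 := sealProb_le_one p _
/-- `0 ≤ seed_k(n,p)`. -/
theorem flatSeal_nonneg (p : unitInterval) (k n : ℕ) : 0 ≤ flatSeal p k n := sealProb_nonneg p _

/-! ## A straight open column crosses the cube: `q_n(p) ≤ 1 - p^n` -/

/-- The `k`-th point of the first coordinate axis of `ℤ³`. -/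
abbrev ax (k : ℤ) : Site 3 := Pi.single (0 : Fin 3) k

/-- The first coordinate of `k e₀` is `k`. -/
theorem ax_apply_zero (k : ℤ) : ax k 0 = k := by simp

/-- The other coordinates of `k e₀` vanish. -/
theorem ax_apply_of_ne {i : Fin 3} (hi : i ≠ 0) (k : ℤ) : ax k i = 0 := by simp [hi]

/-- `k e₀ ∼ (k+1) e₀` in `ℤ³`. -/
theorem ax_adj (k : ℤ) : (zdGraph 3).Adj (ax k) (ax (k + 1)) := by
  rw [zdGraph_adj_iff]
  exact ⟨0, Or.inl (by rw [← Pi.single_add])⟩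

/-- Every coordinate of the cube's upper corner is `n`. -/
theorem cubeHi_apply (n : ℕ) (i : Fin 3) : (![(n : ℤ), (n : ℤ), (n : ℤ)] : Site 3) i = n := by
  fin_cases i <;> rfl

/-- `k e₀ ∈ [0,n]³` for `0 ≤ k ≤ n`. -/
theorem ax_mem_cube {n : ℕ} {k : ℤ} (h0 : 0 ≤ k) (hk : k ≤ n) :
    ax k ∈ Set.Icc (0 : Site 3) ![(n : ℤ), (n : ℤ), (n : ℤ)] := by
  rw [Set.mem_Icc, Pi.le_def, Pi.le_def]
  refine ⟨fun i => ?_, fun i => ?_⟩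
  · by_cases hi : i = 0
    · subst hi; rw [ax_apply_zero]; exact h0
    · rw [ax_apply_of_ne hi]; rfl
  · rw [cubeHi_apply]
    by_cases hi : i = 0
    · subst hi; rw [ax_apply_zero]; exact hk
    · rw [ax_apply_of_ne hi]; exact_mod_cast Nat.zero_le n

/-- **A straight open column crosses the cube**: `p^n ≤ P_p([0,n]³ is crossed from {x₀ = 0} to {x₀ = n})`
(the `n` edges `{k e₀, (k+1) e₀}`, `0 ≤ k < n`, open with probability `p^n`, join `0` to `n e₀` inside the cube;
Grimmett 1999, §1.3, product measure). [folklore] -/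
theorem pow_le_real_cubeCrossing (p : unitInterval) (n : ℕ) :
    (p : ℝ) ^ n ≤ (bondPercolation (zdGraph 3) p).real
      (openCrossing (Set.Icc (0 : Site 3) ![(n : ℤ), (n : ℤ), (n : ℤ)])
        {x | x ∈ Set.Icc (0 : Site 3) ![(n : ℤ), (n : ℤ), (n : ℤ)] ∧ x 0 = 0}
        {y | y ∈ Set.Icc (0 : Site 3) ![(n : ℤ), (n : ℤ), (n : ℤ)] ∧
          y 0 = (![(n : ℤ), (n : ℤ), (n : ℤ)] : Site 3) 0}) := by
  classical
  set S : Set (Site 3) := Set.Icc (0 : Site 3) ![(n : ℤ), (n : ℤ), (n : ℤ)] with hS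
  set F : Finset (Sym2 (Site 3)) := (Finset.range n).image fun k : ℕ => s(ax k, ax ((k : ℤ) + 1))
    with hF
  have hFE : (F : Set (Sym2 (Site 3))) ⊆ (zdGraph 3).edgeSet := by
    intro e he
    rw [hF, Finset.coe_image, Set.mem_image] at he
    obtain ⟨k, -, rfl⟩ := he
    exact (SimpleGraph.mem_edgeSet _).2 (ax_adj k)
  have hcard : F.card ≤ n := Finset.card_image_le.trans (Finset.card_range n).le
  have hsub : {ω : BondConfig (Site 3) | (F : Set (Sym2 (Site 3))) ⊆ ω} ⊆
      openCrossing S {x | x ∈ S ∧ x 0 = 0} {y | y ∈ S ∧ y 0 = (![(n : ℤ), (n : ℤ), (n : ℤ)] : Site 3) 0} := by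
    intro ω hω
    rw [Set.mem_setOf_eq] at hω
    have hmem : ∀ k : ℕ, k ≤ n → ax k ∈ S := fun k hk =>
      ax_mem_cube (by exact_mod_cast Nat.zero_le k) (by exact_mod_cast hk)
    refine ⟨ax ((0 : ℕ) : ℤ), ⟨hmem 0 (Nat.zero_le n), by simp⟩, ax n, ⟨hmem n le_rfl, ?_⟩, ?_⟩
    · rw [ax_apply_zero, cubeHi_apply]
    · apply mem_openConnIn_of_pathIn
      -- an open path along the axis, by induction
      have key : ∀ k : ℕ, k ≤ n → PathIn (openGraph ω) S (ax ((0 : ℕ) : ℤ)) (ax k) := by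
        intro k
        induction k with
        | zero => intro _; exact PathIn.refl (hmem 0 (Nat.zero_le n))
        | succ k ih =>
          intro hk
          have hk' : k < n := Nat.lt_of_succ_le hk
          refine (ih hk'.le).tail ?_ ?_
          · rw [openGraph_adj]
            refine ⟨hω ?_, ?_⟩
            · rw [hF, Finset.coe_image]
              refine ⟨k, Finset.mem_coe.2 (Finset.mem_range.2 hk'), ?_⟩
              push_cast; rfl
            · have := (ax_adj k).ne
              push_cast; exact this
          · exact hmem (k + 1) hk
      exact key n le_rfl
  calc (p : ℝ) ^ n ≤ (p : ℝ) ^ F.card := pow_le_pow_of_le_one p.2.1 p.2.2 hcard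
    _ = (bondPercolation (zdGraph 3) p).real {ω | (F : Set (Sym2 (Site 3))) ⊆ ω} :=
        (bondPercolation_real_setOf_subset (zdGraph 3) p F hFE).symm
    _ ≤ _ := measureReal_mono hsub

/-- **`q_n(p) ≤ 1 - p^n`**. [folklore] -/
theorem cubeSeal_le_one_sub_pow (p : unitInterval) (n : ℕ) : cubeSeal p n ≤ 1 - (p : ℝ) ^ n := by
  unfold cubeSeal sealProb
  rw [probReal_compl_eq_one_sub (measurableSet_openCrossing_of_countable _ _ _)]
  linarith [pow_le_real_cubeCrossing p n]

/-- `q_n(p) < 1` for `p > 0` (every `n`, including `n = 0` where `q_0 = 0`). [folklore] -/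
theorem cubeSeal_lt_one (p : unitInterval) (hp : 0 < (p : ℝ)) (n : ℕ) : cubeSeal p n < 1 := by
  have := cubeSeal_le_one_sub_pow p n
  have hpn : 0 < (p : ℝ) ^ n := pow_pos hp n
  linarith

/-- In particular at `p_c(ℤ³) > 0`. -/
theorem cubeSeal_criticalProb_lt_one (n : ℕ) : cubeSeal (criticalProbI 3) n < 1 :=
  cubeSeal_lt_one _ (criticalProb_zd_pos 3 (by norm_num)) n

/-- `q_n > 0` at `p_c(ℤ³)` for `n ≥ 2`, from the LANDED sandwich `0 < u_n ≤ q_n⁶`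
(`blockProb_criticalProb_three_pos`, `stub_upperSandwich`). -/
theorem cubeSeal_criticalProb_pos {n : ℕ} (hn : 2 ≤ n) : 0 < cubeSeal (criticalProbI 3) n := by
  have h6 : 0 < cubeSeal (criticalProbI 3) n ^ 6 :=
    (blockProb_criticalProb_three_pos (by omega)).trans_le (stub_upperSandwich n hn)
  rcases (cubeSeal_nonneg (criticalProbI 3) n).lt_or_eq with h | h
  · exact h
  · rw [← h] at h6; norm_num at h6

/-! ## Restriction: `seed_k(n) ≤ q_n`, and the degenerate parameter `k = 0` -/

/-- **`seed_k(n,p) ≤ q_n(p)`**: a seal of the flat seed restricts to a seal of the cube `[0,n]³ ⊆ [0,n] × [0,n+⌊n/k⌋]²`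
(same extent in the sealing direction; `StubTiling.seal_mono`). So `stub_comparison` reads `c q_n^C ≤ seed_k(n) ≤ q_n`. -/
theorem flatSeal_le_cubeSeal (p : unitInterval) (k n : ℕ) : flatSeal p k n ≤ cubeSeal p n := by
  unfold flatSeal cubeSeal sealProb
  refine measureReal_mono (StubTiling.seal_mono le_rfl ?_ rfl rfl)
  rw [Pi.le_def]
  intro i
  fin_cases i <;> simp <;> positivity

/-- At `k = 0` the seed IS the cube (`n / 0 = 0`). -/
theorem flatSeal_zero (p : unitInterval) (n : ℕ) : flatSeal p 0 n = cubeSeal p n := by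
  unfold flatSeal cubeSeal
  rw [Nat.div_zero, Nat.cast_zero, add_zero]

/-- **The guard `1 ≤ k` of `stub_comparison` is load-bearing against TRIVIALITY**: without it the statement holds with
`k = 0`, `C = 1`, `c = 1` at every parameter `p` (the seed is then the cube itself). -/
theorem seedFromCube_without_guard (p : unitInterval) :
    ∃ k : ℕ, ∃ (C : ℕ) (c : ℝ), 0 < c ∧ ∀ᶠ n : ℕ in atTop, c * cubeSeal p n ^ C ≤ flatSeal p k n :=
  ⟨0, 1, 1, one_pos, Eventually.of_forall fun n => by rw [flatSeal_zero, one_mul, pow_one]⟩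

/-! ## Refuted natural strengthenings of `stub_anchor` at `p_c(ℤ³)` -/

/-- **Refuted strengthening 1 (no eventuality)**: `∀ s > 0, ∀ n ≥ 1, n^{-s} ≤ q_n` is FALSE (at `n = 1`,
`1^{-s} = 1 > q_1 = (1 - p_c)^4`). -/
theorem not_cubeSealSubpoly_forall_n :
    ¬ ∀ s : ℝ, 0 < s → ∀ n : ℕ, 1 ≤ n → (n : ℝ) ^ (-s) ≤ cubeSeal (criticalProbI 3) n := by
  intro h
  have := h 1 one_pos 1 le_rfl
  rw [Nat.cast_one, Real.one_rpow] at this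
  linarith [cubeSeal_criticalProb_lt_one 1]

/-- **Refuted strengthening 2 (the endpoint `s = 0`)**: `q_n ≥ n^{0} = 1` eventually is FALSE. -/
theorem not_cubeSeal_exponent_zero :
    ¬ ∀ᶠ n : ℕ in atTop, (n : ℝ) ^ (-(0 : ℝ)) ≤ cubeSeal (criticalProbI 3) n := by
  intro h
  rw [eventually_atTop] at h
  obtain ⟨N, hN⟩ := h
  have := hN N le_rfl
  rw [neg_zero, Real.rpow_zero] at this
  linarith [cubeSeal_criticalProb_lt_one N]

/-- **Refuted strengthening 3 (quantifier order)**: the eventuality of `stub_anchor` cannot be uniform in `s`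
(`∃ N ∀ s > 0 ∀ n ≥ N, n^{-s} ≤ q_n` is FALSE: `sup_{s>0} n^{-s} = 1 > q_n`). -/
theorem not_cubeSealSubpoly_uniform_in_s :
    ¬ ∃ N : ℕ, ∀ s : ℝ, 0 < s → ∀ n : ℕ, N ≤ n → (n : ℝ) ^ (-s) ≤ cubeSeal (criticalProbI 3) n := by
  rintro ⟨N, hN⟩
  set n : ℕ := N + 1 with hn
  set b : ℝ := cubeSeal (criticalProbI 3) n with hbdef
  have hb : b < 1 := cubeSeal_criticalProb_lt_one n
  have h1b : 0 < 1 - b := by linarith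
  have hn0 : (0 : ℝ) < n := by rw [hn]; positivity
  have hn1 : (1 : ℝ) ≤ n := by rw [hn]; exact_mod_cast Nat.succ_le_succ (Nat.zero_le N)
  have hlog : 0 ≤ Real.log n := Real.log_nonneg hn1
  set s : ℝ := (1 - b) / (2 * (Real.log n + 1)) with hs
  have hs0 : 0 < s := div_pos h1b (by positivity)
  have key := hN s hs0 n (Nat.le_succ N)
  have h1 : 1 - s * Real.log n ≤ (n : ℝ) ^ (-s) := by
    rw [Real.rpow_def_of_pos hn0]
    have := Real.add_one_le_exp (Real.log n * (-s))
    linarith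
  have h2 : s * Real.log n < 1 - b := by
    have e : s * (Real.log n + 1) = (1 - b) / 2 := by
      rw [hs]; field_simp
    nlinarith
  have : (n : ℝ) ^ (-s) ≤ b := key
  linarith

/-! ## Readback: the registered open stubs in this vocabulary (definitional) -/

/-- `stub_anchor` is `∀ s > 0, ∀ᶠ n, n^{-s} ≤ cubeSeal p_c n`. -/
theorem stub_anchor_iff :
    (∀ s : ℝ, 0 < s → ∀ᶠ n : ℕ in atTop,
      (n : ℝ) ^ (-s) ≤
        (bondPercolation (zdGraph 3) (criticalProbI 3)).real
          (openCrossing (Set.Icc (0 : Site 3) ![(n : ℤ), (n : ℤ), (n : ℤ)])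
            {x | x ∈ Set.Icc (0 : Site 3) ![(n : ℤ), (n : ℤ), (n : ℤ)] ∧ x 0 = 0}
            {y | y ∈ Set.Icc (0 : Site 3) ![(n : ℤ), (n : ℤ), (n : ℤ)] ∧ y 0 = (n : ℤ)})ᶜ) ↔
    (∀ s : ℝ, 0 < s → ∀ᶠ n : ℕ in atTop, (n : ℝ) ^ (-s) ≤ cubeSeal (criticalProbI 3) n) := Iff.rfl

/-- `stub_comparison` is `∃ k ≥ 1, ∃ C c > 0, ∀ᶠ n, c (cubeSeal p_c n)^C ≤ flatSeal p_c k n`. -/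
theorem stub_comparison_iff :
    (∃ k : ℕ, 1 ≤ k ∧ ∃ (C : ℕ) (c : ℝ), 0 < c ∧ ∀ᶠ n : ℕ in atTop,
      c * (bondPercolation (zdGraph 3) (criticalProbI 3)).real
          (openCrossing (Set.Icc (0 : Site 3) ![(n : ℤ), (n : ℤ), (n : ℤ)])
            {x | x ∈ Set.Icc (0 : Site 3) ![(n : ℤ), (n : ℤ), (n : ℤ)] ∧ x 0 = 0}
            {y | y ∈ Set.Icc (0 : Site 3) ![(n : ℤ), (n : ℤ), (n : ℤ)] ∧ y 0 = (n : ℤ)})ᶜ ^ C ≤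
        (bondPercolation (zdGraph 3) (criticalProbI 3)).real
          (openCrossing (Set.Icc (0 : Site 3) ![(n : ℤ), (n : ℤ) + (n / k : ℕ), (n : ℤ) + (n / k : ℕ)])
            {x | x ∈ Set.Icc (0 : Site 3) ![(n : ℤ), (n : ℤ) + (n / k : ℕ), (n : ℤ) + (n / k : ℕ)] ∧ x 0 = 0}
            {y | y ∈ Set.Icc (0 : Site 3) ![(n : ℤ), (n : ℤ) + (n / k : ℕ), (n : ℤ) + (n / k : ℕ)] ∧
              y 0 = (n : ℤ)})ᶜ) ↔
    (∃ k : ℕ, 1 ≤ k ∧ ∃ (C : ℕ) (c : ℝ), 0 < c ∧ ∀ᶠ n : ℕ in atTop,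
      c * cubeSeal (criticalProbI 3) n ^ C ≤ flatSeal (criticalProbI 3) k n) := Iff.rfl

end Summit.CriticalPhenomena.PercolationContinuityZ3.Theorems.SubpolynomialBlocking.Negative

end
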